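import Summits.BirchSwinnertonDyer.BirchSwinnertonDyer.Theorems.ResidualThetaTransportAtTwoHeckeThetaPartnerAdicAtTwoThetaGram
import Literature.NumberTheory.ModularForms.BinaryThetaNull
import HarnessLib

/-!
# The `q`-expansion of the theta null of an ideal lattice (toward K0⁺, stmt-20690)

Route `ResidualThetaTransportAtTwo`, crux K0⁺ `HeckeThetaPartnerAdicAtTwo` (stmt-BirchSwinnertonDyer-20690),
line "Hecke theta series from the genus-two Riemann theta function".  THEOREMS ONLY.

For Gram data `(b, B)` of a nonzero ideal `𝔟` of an imaginary quadratic field (`ThetaGram.exists_gram`: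
`B_{ij} N𝔟 = σbᵢ \overline{σbⱼ} + \overline{σbᵢ} σbⱼ`), the theta null
`θ_B(τ) = ϑ[0;0](0, τ·B) = Σ_{m ∈ ℤ²} e(πi τ ᵗmBm)` is the lattice sum `Σ_{x ∈ 𝔟} q^{N(x)/N𝔟}`
(Hecke 1926 §2), i.e. the `q`-series `Σ_{n ≥ 0} r_𝔟(n) qⁿ` with
`r_𝔟(n) = #{x ∈ 𝔟 : N((x)) = n · N𝔟}`:

* `dotProduct_mulVec_eq_two_mul` — `ᵗmBm · N𝔟 = 2 N(x_m)`, `x_m = Σ mᵢbᵢ`;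
* `finite_norm_eq` — `{x ∈ 𝔟 : N((x)) = n N𝔟}` is finite; `natCard_norm_eq_zero` — `r_𝔟(0) = 1`;
* **`hasSum_thetaNull_qExpansion`** — `HasSum (n ↦ r_𝔟(n) qⁿ) θ_B(τ)` for `Im τ > 0`;
* `thetaNull_periodic`, `tendsto_thetaNull_atImInfty` — `θ_B(τ+1) = θ_B(τ)`, `θ_B(iy) → 1`.

BSD is not proved by this file.
-/

set_option autoImplicit false
set_option linter.dupNamespace false

noncomputable section

open scoped NumberField ComplexConjugate Real Topology
open NumberField Module Matrix Complex Filter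

namespace Summit.BirchSwinnertonDyer.BirchSwinnertonDyer.Theorems.HeckeTheta

open Literature.Analysis.SpecialFunctions
open Literature.NumberTheory.ModularForms.BinaryTheta
open Literature.NumberTheory.Automorphic (siegelUpperHalfSpace mem_siegelUpperHalfSpace_iff)

variable {K : Type} [Field K] [NumberField K]

/-! ### The quadratic form in coordinates -/

/-- **`ᵗm B m · N𝔟 = 2 |N(x_m)|`** for `x_m = Σ mᵢ bᵢ ∈ 𝔟`, from the entry formula of the Gram
matrix (`Σ mᵢmⱼ(uᵢūⱼ + ūᵢuⱼ) = 2|Σ mᵢuᵢ|² = 2‖σ x_m‖² = 2|N(x_m)|`). -/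
theorem dotProduct_mulVec_eq_two_mul (hK : finrank ℚ K = 2) [IsTotallyComplex K] (σ : K →+* ℂ)
    {𝔟 : Ideal (𝓞 K)} (b : Basis (Fin 2) ℤ 𝔟) {B : Matrix (Fin 2) (Fin 2) ℤ}
    (hB : ∀ i j, ((B i j : ℤ) : ℂ) * ((Ideal.absNorm 𝔟 : ℕ) : ℂ) =
      σ ((b i : 𝓞 K) : K) * conj (σ ((b j : 𝓞 K) : K)) + conj (σ ((b i : 𝓞 K) : K)) * σ ((b j : 𝓞 K) : K))
    (m : Fin 2 → ℤ) :
    (m ⬝ᵥ (B *ᵥ m)) * (Ideal.absNorm 𝔟 : ℤ) =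
      2 * |Algebra.norm ℤ ((b.equivFun.symm m : 𝔟) : 𝓞 K)| := by
  set x : 𝓞 K := ((b.equivFun.symm m : 𝔟) : 𝓞 K) with hx
  have hxsum : (x : K) = ∑ i, (m i : K) * ((b i : 𝓞 K) : K) := by
    rw [hx, Basis.equivFun_symm_apply]
    push_cast
    simp [zsmul_eq_mul]
  set u : Fin 2 → ℂ := fun i => σ ((b i : 𝓞 K) : K) with hu
  have hσx : σ (x : K) = ∑ i, (m i : ℂ) * u i := by
    rw [hxsum, map_sum]
    simp [hu]
  have hnorm : (((Algebra.norm ℤ x).natAbs : ℕ) : ℂ) = σ (x : K) * conj (σ (x : K)) := by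
    have h1 := normSq_embedding_eq hK σ x
    rw [Complex.mul_conj, Complex.normSq_eq_norm_sq, h1]
    exact (Complex.ofReal_natCast _).symm
  have key : ((m ⬝ᵥ (B *ᵥ m) : ℤ) : ℂ) * ((Ideal.absNorm 𝔟 : ℕ) : ℂ) =
      2 * (σ (x : K) * conj (σ (x : K))) := by
    rw [hσx, map_sum]
    simp only [dotProduct, Matrix.mulVec, Fin.sum_univ_two, map_mul, map_intCast]
    push_cast
    have e00 := hB 0 0
    have e01 := hB 0 1
    have e10 := hB 1 0
    have e11 := hB 1 1
    simp only [hu] at e00 e01 e10 e11 ⊢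
    linear_combination (↑(m 0) : ℂ) ^ 2 * e00 + (↑(m 0) : ℂ) * (↑(m 1) : ℂ) * e01 +
      (↑(m 1) : ℂ) * (↑(m 0) : ℂ) * e10 + (↑(m 1) : ℂ) ^ 2 * e11
  rw [← hnorm] at key
  rw [← Int.natCast_natAbs]
  have key2 : (((m ⬝ᵥ (B *ᵥ m)) * (Ideal.absNorm 𝔟 : ℤ) : ℤ) : ℂ) =
      ((2 * ((Algebra.norm ℤ x).natAbs : ℤ) : ℤ) : ℂ) := by
    simp only [Int.cast_mul, Int.cast_ofNat, Int.cast_natCast]; exact key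
  exact Int.cast_injective key2

/-- The value `N((x_m))/N𝔟 ∈ ℕ` with `ᵗm B m = 2 · (N((x_m))/N𝔟)`. -/
theorem dotProduct_mulVec_eq_two_mul_div (hK : finrank ℚ K = 2) [IsTotallyComplex K] (σ : K →+* ℂ)
    {𝔟 : Ideal (𝓞 K)} (h𝔟 : 𝔟 ≠ ⊥) (b : Basis (Fin 2) ℤ 𝔟) {B : Matrix (Fin 2) (Fin 2) ℤ}
    (hB : ∀ i j, ((B i j : ℤ) : ℂ) * ((Ideal.absNorm 𝔟 : ℕ) : ℂ) =
      σ ((b i : 𝓞 K) : K) * conj (σ ((b j : 𝓞 K) : K)) + conj (σ ((b i : 𝓞 K) : K)) * σ ((b j : 𝓞 K) : K))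
    (m : Fin 2 → ℤ) :
    m ⬝ᵥ (B *ᵥ m) =
      2 * ((Ideal.absNorm (Ideal.span {((b.equivFun.symm m : 𝔟) : 𝓞 K)}) / Ideal.absNorm 𝔟 : ℕ) : ℤ) := by
  have hN0 : Ideal.absNorm 𝔟 ≠ 0 := by rw [Ne, Ideal.absNorm_eq_zero_iff]; exact h𝔟
  have h := dotProduct_mulVec_eq_two_mul hK σ b hB m
  rw [← Int.natCast_natAbs] at h
  rw [Ideal.absNorm_span_singleton]
  have hdvd := absNorm_dvd_natAbs_norm ((b.equivFun.symm m : 𝔟)).2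
  obtain ⟨k, hk⟩ := hdvd
  rw [hk, Nat.mul_div_cancel_left _ (Nat.pos_of_ne_zero hN0)]
  rw [hk] at h
  push_cast at h
  have hN0' : (Ideal.absNorm 𝔟 : ℤ) ≠ 0 := by exact_mod_cast hN0
  have : (m ⬝ᵥ (B *ᵥ m)) * (Ideal.absNorm 𝔟 : ℤ) = (2 * (k : ℤ)) * (Ideal.absNorm 𝔟 : ℤ) := by
    rw [h]; ring
  exact mul_right_cancel₀ hN0' this

/-! ### The theta null as a `q`-series -/

/-- The general term at `v = 0`, characteristic `0`: `e(πi τ ᵗmBm) = q^{N((x_m))/N𝔟}`,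
`q = e(τ)`. -/
theorem riemannThetaCharTerm_smul_eq_pow (hK : finrank ℚ K = 2) [IsTotallyComplex K] (σ : K →+* ℂ)
    {𝔟 : Ideal (𝓞 K)} (h𝔟 : 𝔟 ≠ ⊥) (b : Basis (Fin 2) ℤ 𝔟) {B : Matrix (Fin 2) (Fin 2) ℤ}
    (hB : ∀ i j, ((B i j : ℤ) : ℂ) * ((Ideal.absNorm 𝔟 : ℕ) : ℂ) =
      σ ((b i : 𝓞 K) : K) * conj (σ ((b j : 𝓞 K) : K)) + conj (σ ((b i : 𝓞 K) : K)) * σ ((b j : 𝓞 K) : K))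
    (τ : ℂ) (m : Fin 2 → ℤ) :
    riemannThetaCharTerm 0 0 (τ • B.map ((↑) : ℤ → ℂ)) 0 m =
      cexp (2 * π * I * τ) ^
        (Ideal.absNorm (Ideal.span {((b.equivFun.symm m : 𝔟) : 𝓞 K)}) / Ideal.absNorm 𝔟) := by
  set k : ℕ := Ideal.absNorm (Ideal.span {((b.equivFun.symm m : 𝔟) : 𝓞 K)}) / Ideal.absNorm 𝔟 with hk
  have hq := dotProduct_mulVec_eq_two_mul_div hK σ h𝔟 b hB m
  rw [← hk] at hq
  rw [riemannThetaCharTerm, ← Complex.exp_nat_mul]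
  congr 1
  simp only [add_zero, dotProduct_zero, mul_zero]
  -- `ᵗm (τB) m = τ ᵗmBm`
  have hquad : ((fun i => (m i : ℂ)) ⬝ᵥ ((τ • B.map ((↑) : ℤ → ℂ)) *ᵥ fun i => (m i : ℂ))) =
      τ * ((m ⬝ᵥ (B *ᵥ m) : ℤ) : ℂ) := by
    simp only [dotProduct, Matrix.mulVec, Fin.sum_univ_two, Matrix.smul_apply, Matrix.map_apply,
      smul_eq_mul]
    push_cast
    ring
  rw [hquad, hq]
  push_cast
  ring

/-- **`{x ∈ 𝔟 : N((x)) = n·N𝔟}` is finite** (imaginary quadratic: `‖φ x‖² = N((x))` for both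
embeddings `φ`, and integral points of bounded absolute value are finite,
`NumberField.Embeddings.finite_of_norm_le`). -/
theorem finite_norm_eq (hK : finrank ℚ K = 2) [IsTotallyComplex K] (𝔟 : Ideal (𝓞 K)) (n : ℕ) :
    Finite {x : 𝓞 K // x ∈ 𝔟 ∧ Ideal.absNorm (Ideal.span {x}) = n * Ideal.absNorm 𝔟} := by
  have hfin := NumberField.Embeddings.finite_of_norm_le K ℂ (Real.sqrt (n * Ideal.absNorm 𝔟))
  haveI := hfin.to_subtype
  refine Finite.of_injective (fun x => (⟨((x.1 : 𝓞 K) : K), ?_⟩ : {x : K // x ∈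
      {x : K | IsIntegral ℤ x ∧ ∀ φ : K →+* ℂ, ‖φ x‖ ≤ Real.sqrt (n * Ideal.absNorm 𝔟)}})) ?_
  · refine ⟨x.1.isIntegral_coe, fun φ => ?_⟩
    have h := normSq_embedding_eq hK φ x.1
    rw [← Ideal.absNorm_span_singleton, x.2.2] at h
    rw [← Real.sqrt_sq (norm_nonneg _), h]
    push_cast
    exact le_rfl
  · intro x y hxy
    apply Subtype.ext
    exact NumberField.RingOfIntegers.coe_injective (by simpa using congrArg Subtype.val hxy)

/-- `r_𝔟(0) = 1`: only `x = 0` has norm `0`. -/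
theorem natCard_norm_eq_zero (𝔟 : Ideal (𝓞 K)) :
    Nat.card {x : 𝓞 K // x ∈ 𝔟 ∧ Ideal.absNorm (Ideal.span {x}) = 0 * Ideal.absNorm 𝔟} = 1 := by
  rw [Nat.card_eq_one_iff_exists]
  refine ⟨⟨0, 𝔟.zero_mem, by simp⟩, fun y => Subtype.ext ?_⟩
  obtain ⟨x, hx, h⟩ := y
  rw [zero_mul, Ideal.absNorm_eq_zero_iff, Ideal.span_singleton_eq_bot] at h
  exact h

/-- **The `q`-expansion of the theta null of an ideal lattice**: for Gram data `(b, B)` of `𝔟 ≠ 0`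
and `Im τ > 0`, `θ_B(τ) = ϑ[0;0](0, τ·B) = Σ_{n ≥ 0} r_𝔟(n) qⁿ` with
`r_𝔟(n) = #{x ∈ 𝔟 : N((x)) = n·N𝔟}` (Hecke 1926 §2: `θ_𝔟(τ) = Σ_{x ∈ 𝔟} q^{N(x)/N𝔟}`). -/
theorem hasSum_thetaNull_qExpansion (hK : finrank ℚ K = 2) [IsTotallyComplex K] (σ : K →+* ℂ)
    {𝔟 : Ideal (𝓞 K)} (h𝔟 : 𝔟 ≠ ⊥) (b : Basis (Fin 2) ℤ 𝔟) {B : Matrix (Fin 2) (Fin 2) ℤ}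
    (hB : ∀ i j, ((B i j : ℤ) : ℂ) * ((Ideal.absNorm 𝔟 : ℕ) : ℂ) =
      σ ((b i : 𝓞 K) : K) * conj (σ ((b j : 𝓞 K) : K)) + conj (σ ((b i : 𝓞 K) : K)) * σ ((b j : 𝓞 K) : K))
    (hsymm : B.IsSymm) (hpos : (B.map (Int.cast : ℤ → ℝ)).PosDef) {τ : ℂ} (hτ : 0 < τ.im) :
    HasSum (fun n : ℕ => (Nat.card {x : 𝓞 K // x ∈ 𝔟 ∧ Ideal.absNorm (Ideal.span {x}) = n * Ideal.absNorm 𝔟} : ℂ) *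
        cexp (2 * π * I * τ) ^ n)
      (riemannThetaChar 0 0 (τ • B.map ((↑) : ℤ → ℂ)) 0) := by
  classical
  have hZ := smul_mem_siegelUpperHalfSpace hsymm hpos hτ
  obtain ⟨c, hc, hY⟩ := exists_pos_mul_sum_sq_le_of_posDef_im _ hZ.2
  have hZs : ∀ i j, (τ • B.map ((↑) : ℤ → ℂ)) i j = (τ • B.map ((↑) : ℤ → ℂ)) j i :=
    fun i j => (hZ.1.apply i j).symm
  have hsum := hasSum_riemannThetaChar _ hZs hc hY 0 0 0
  -- the norm index `k(m) = N((x_m))/N𝔟` and its fibres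
  set kf : (Fin 2 → ℤ) → ℕ := fun m =>
    Ideal.absNorm (Ideal.span {((b.equivFun.symm m : 𝔟) : 𝓞 K)}) / Ideal.absNorm 𝔟 with hkf
  have hN0 : Ideal.absNorm 𝔟 ≠ 0 := by rw [Ne, Ideal.absNorm_eq_zero_iff]; exact h𝔟
  have hkf_iff : ∀ m n, kf m = n ↔
      Ideal.absNorm (Ideal.span {((b.equivFun.symm m : 𝔟) : 𝓞 K)}) = n * Ideal.absNorm 𝔟 := by
    intro m n
    obtain ⟨k, hk⟩ := (show Ideal.absNorm 𝔟 ∣ Ideal.absNorm (Ideal.span {((b.equivFun.symm m : 𝔟) : 𝓞 K)})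
      from by rw [Ideal.absNorm_span_singleton]; exact absNorm_dvd_natAbs_norm (b.equivFun.symm m).2)
    rw [hkf]; simp only
    rw [hk, Nat.mul_div_cancel_left _ (Nat.pos_of_ne_zero hN0), mul_comm]
    exact ⟨fun h => by rw [h], fun h => mul_right_cancel₀ hN0 h⟩
  -- fibres inject into `{x ∈ 𝔟 : N((x)) = n N𝔟}` (in fact bijectively)
  set g : ∀ n, {m : Fin 2 → ℤ // kf m = n} →
      {x : 𝓞 K // x ∈ 𝔟 ∧ Ideal.absNorm (Ideal.span {x}) = n * Ideal.absNorm 𝔟} :=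
    fun n m => ⟨((b.equivFun.symm m.1 : 𝔟) : 𝓞 K), (b.equivFun.symm m.1).2, (hkf_iff m.1 n).mp m.2⟩ with hg
  have hg_bij : ∀ n, Function.Bijective (g n) := by
    intro n
    constructor
    · intro m m' h
      have h' : ((b.equivFun.symm m.1 : 𝔟) : 𝓞 K) = ((b.equivFun.symm m'.1 : 𝔟) : 𝓞 K) :=
        congrArg (fun z => (z.1 : 𝓞 K)) h
      exact Subtype.ext (b.equivFun.symm.injective (Subtype.ext h'))
    · rintro ⟨x, hx, hxn⟩
      refine ⟨⟨b.equivFun ⟨x, hx⟩, ?_⟩, ?_⟩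
      · rw [hkf_iff, LinearEquiv.symm_apply_apply]; exact hxn
      · apply Subtype.ext
        simp only [hg]
        exact congrArg Subtype.val (b.equivFun.symm_apply_apply ⟨x, hx⟩)
  have hfib : ∀ n, Nat.card {m : Fin 2 → ℤ // kf m = n} =
      Nat.card {x : 𝓞 K // x ∈ 𝔟 ∧ Ideal.absNorm (Ideal.span {x}) = n * Ideal.absNorm 𝔟} :=
    fun n => Nat.card_congr (Equiv.ofBijective (g n) (hg_bij n))
  haveI hfin : ∀ n, Finite {m : Fin 2 → ℤ // kf m = n} := fun n =>
    haveI := finite_norm_eq hK 𝔟 n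
    Finite.of_injective (g n) (hg_bij n).1
  -- regroup the lattice sum along the fibres of `kf`
  have h1 : HasSum ((riemannThetaCharTerm 0 0 (τ • B.map ((↑) : ℤ → ℂ)) 0) ∘ (Equiv.sigmaFiberEquiv kf))
      (riemannThetaChar 0 0 (τ • B.map ((↑) : ℤ → ℂ)) 0) :=
    (Equiv.hasSum_iff (Equiv.sigmaFiberEquiv kf)).mpr hsum
  refine h1.sigma fun n => ?_
  letI : Fintype {m : Fin 2 → ℤ // kf m = n} := Fintype.ofFinite _
  have hterm : ∀ c : {m : Fin 2 → ℤ // kf m = n},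
      ((riemannThetaCharTerm 0 0 (τ • B.map ((↑) : ℤ → ℂ)) 0) ∘ (Equiv.sigmaFiberEquiv kf)) ⟨n, c⟩ =
        cexp (2 * π * I * τ) ^ n := by
    intro c
    simp only [Function.comp_apply, Equiv.sigmaFiberEquiv_apply]
    rw [riemannThetaCharTerm_smul_eq_pow hK σ h𝔟 b hB τ c.1]
    congr 1
    exact c.2
  have h2 := hasSum_fintype (fun c : {m : Fin 2 → ℤ // kf m = n} =>
    ((riemannThetaCharTerm 0 0 (τ • B.map ((↑) : ℤ → ℂ)) 0) ∘ (Equiv.sigmaFiberEquiv kf)) ⟨n, c⟩)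
  simp only [hterm, Finset.sum_const, Finset.card_univ, nsmul_eq_mul] at h2
  rw [← Nat.card_eq_fintype_card, hfib n] at h2
  simpa only [hterm] using h2

/-- **`θ_B(τ + 1) = θ_B(τ)`** (the `q`-series only sees `e(τ)`). -/
theorem thetaNull_periodic (hK : finrank ℚ K = 2) [IsTotallyComplex K] (σ : K →+* ℂ)
    {𝔟 : Ideal (𝓞 K)} (h𝔟 : 𝔟 ≠ ⊥) (b : Basis (Fin 2) ℤ 𝔟) {B : Matrix (Fin 2) (Fin 2) ℤ}
    (hB : ∀ i j, ((B i j : ℤ) : ℂ) * ((Ideal.absNorm 𝔟 : ℕ) : ℂ) =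
      σ ((b i : 𝓞 K) : K) * conj (σ ((b j : 𝓞 K) : K)) + conj (σ ((b i : 𝓞 K) : K)) * σ ((b j : 𝓞 K) : K))
    (hsymm : B.IsSymm) (hpos : (B.map (Int.cast : ℤ → ℝ)).PosDef) {τ : ℂ} (hτ : 0 < τ.im) :
    riemannThetaChar 0 0 ((τ + 1) • B.map ((↑) : ℤ → ℂ)) 0 = riemannThetaChar 0 0 (τ • B.map ((↑) : ℤ → ℂ)) 0 := by
  have hτ' : 0 < (τ + 1).im := by simpa using hτ
  have h1 := hasSum_thetaNull_qExpansion hK σ h𝔟 b hB hsymm hpos hτ'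
  have h2 := hasSum_thetaNull_qExpansion hK σ h𝔟 b hB hsymm hpos hτ
  have hq : cexp (2 * π * I * (τ + 1)) = cexp (2 * π * I * τ) := by
    rw [mul_add, mul_one, Complex.exp_add, Complex.exp_two_pi_mul_I, mul_one]
  rw [hq] at h1
  exact h1.unique h2

/-- **`θ_B(τ) → 1` as `Im τ → ∞`** (the constant term is `r_𝔟(0) = 1`): for `y ≥ 1`,
`|θ_B(iy·) - 1| ≤ C e^{-2πy}`.  Stated along `τ = x + iy` with `y → ∞` uniformly is not needed; we
record the sequential form along the imaginary axis used downstream. -/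
theorem tendsto_thetaNull_atImInfty (hK : finrank ℚ K = 2) [IsTotallyComplex K] (σ : K →+* ℂ)
    {𝔟 : Ideal (𝓞 K)} (h𝔟 : 𝔟 ≠ ⊥) (b : Basis (Fin 2) ℤ 𝔟) {B : Matrix (Fin 2) (Fin 2) ℤ}
    (hB : ∀ i j, ((B i j : ℤ) : ℂ) * ((Ideal.absNorm 𝔟 : ℕ) : ℂ) =
      σ ((b i : 𝓞 K) : K) * conj (σ ((b j : 𝓞 K) : K)) + conj (σ ((b i : 𝓞 K) : K)) * σ ((b j : 𝓞 K) : K))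
    (hsymm : B.IsSymm) (hpos : (B.map (Int.cast : ℤ → ℝ)).PosDef) :
    Tendsto (fun y : ℝ => riemannThetaChar 0 0 (((y : ℂ) * I) • B.map ((↑) : ℤ → ℂ)) 0) atTop (𝓝 1) := by
  -- coefficients and the majorant at `y = 1`
  set r : ℕ → ℂ := fun n =>
    (Nat.card {x : 𝓞 K // x ∈ 𝔟 ∧ Ideal.absNorm (Ideal.span {x}) = n * Ideal.absNorm 𝔟} : ℂ) with hr
  have hr0 : r 0 = 1 := by
    simp only [hr]
    rw [natCard_norm_eq_zero 𝔟]
    simp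
  have hrnn : ∀ n, 0 ≤ (r n).re ∧ (r n).im = 0 := fun n => by simp [hr]
  set q₁ : ℝ := Real.exp (-2 * π) with hq₁
  have hq₁pos : 0 < q₁ := Real.exp_pos _
  have hIim : ∀ y : ℝ, (((y : ℂ) * I)).im = y := fun y => by simp
  have hqnorm : ∀ y : ℝ, ‖cexp (2 * π * I * ((y : ℂ) * I))‖ = Real.exp (-2 * π * y) := by
    intro y
    rw [show (2 : ℂ) * π * I * ((y : ℂ) * I) = ((-2 * π * y : ℝ) : ℂ) by
      push_cast; linear_combination (2 * π * y : ℂ) * Complex.I_sq, Complex.norm_exp, Complex.ofReal_re]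
  -- summability of `Σ r(n) q₁ⁿ` from the `HasSum` at `y = 1`
  have hS1 := hasSum_thetaNull_qExpansion hK σ h𝔟 b hB hsymm hpos (τ := ((1 : ℝ) : ℂ) * I)
    (by rw [hIim]; exact one_pos)
  have hS1' : HasSum (fun n : ℕ => r n * cexp (2 * π * I * (((1 : ℝ) : ℂ) * I)) ^ n)
      (riemannThetaChar 0 0 ((((1 : ℝ) : ℂ) * I) • B.map ((↑) : ℤ → ℂ)) 0) := hS1
  have hsumm1 : Summable fun n : ℕ => ‖r n‖ * q₁ ^ n := by
    refine hS1'.summable.norm.congr fun n => ?_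
    rw [norm_mul, norm_pow, hqnorm, hq₁]; ring_nf
  set C : ℝ := ∑' n : ℕ, ‖r (n + 1)‖ * q₁ ^ n with hC
  have hCsum : Summable fun n : ℕ => ‖r (n + 1)‖ * q₁ ^ n := by
    have h := (summable_nat_add_iff 1).mpr hsumm1
    refine (h.mul_left q₁⁻¹).congr fun n => ?_
    simp only [pow_succ]
    field_simp
  have hC0 : 0 ≤ C := tsum_nonneg fun n => by positivity
  -- the estimate `‖θ(iy) - 1‖ ≤ C e^{-2πy}` for `y ≥ 1`
  rw [Metric.tendsto_atTop]
  intro ε hε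
  obtain ⟨Y, hY⟩ : ∃ Y : ℝ, ∀ y ≥ Y, C * Real.exp (-2 * π * y) < ε ∧ 1 ≤ y := by
    have ht : Tendsto (fun y : ℝ => C * Real.exp (-2 * π * y)) atTop (𝓝 0) := by
      have : Tendsto (fun y : ℝ => Real.exp (-2 * π * y)) atTop (𝓝 0) := by
        have h := Real.tendsto_exp_atBot.comp (tendsto_id.const_mul_atTop_of_neg
          (show (-2 * π : ℝ) < 0 by nlinarith [Real.pi_pos]))
        exact h
      simpa using this.const_mul C
    have hev := (ht.eventually (gt_mem_nhds hε)).and (eventually_ge_atTop (1 : ℝ))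
    obtain ⟨Y, hY⟩ := hev.exists_forall_of_atTop
    exact ⟨Y, fun y hy => hY y hy⟩
  refine ⟨Y, fun y hy => ?_⟩
  obtain ⟨hlt, hy1⟩ := hY y hy
  have hypos : 0 < y := by linarith
  have hS := hasSum_thetaNull_qExpansion hK σ h𝔟 b hB hsymm hpos (τ := (y : ℂ) * I) (by rw [hIim]; exact hypos)
  set q : ℂ := cexp (2 * π * I * ((y : ℂ) * I)) with hqdef
  have hqle : ‖q‖ ≤ q₁ := by
    rw [hqdef, hqnorm, hq₁]
    exact Real.exp_le_exp.mpr (by nlinarith [Real.pi_pos])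
  -- split off the constant term
  have hS2 : HasSum (fun n : ℕ => r n * q ^ n) (riemannThetaChar 0 0 (((y : ℂ) * I) • B.map ((↑) : ℤ → ℂ)) 0) := hS
  have hS' := (hasSum_nat_add_iff' 1).mpr hS2
  simp only [Finset.range_one, Finset.sum_singleton, pow_zero, mul_one, hr0] at hS'
  rw [dist_eq_norm]
  have hbound : ‖riemannThetaChar 0 0 (((y : ℂ) * I) • B.map ((↑) : ℤ → ℂ)) 0 - 1‖ ≤ C * Real.exp (-2 * π * y) := by
    rw [← hS'.tsum_eq]
    have hle : ∀ n : ℕ, ‖r (n + 1) * q ^ (n + 1)‖ ≤ (‖r (n + 1)‖ * q₁ ^ n) * Real.exp (-2 * π * y) := by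
      intro n
      rw [norm_mul, norm_pow, pow_succ, ← mul_assoc]
      have hqn : ‖q‖ ^ n ≤ q₁ ^ n := pow_le_pow_left₀ (norm_nonneg _) hqle n
      rw [hqdef, hqnorm] at hqn ⊢
      have : ‖r (n+1)‖ * Real.exp (-2 * π * y) ^ n ≤ ‖r (n + 1)‖ * q₁ ^ n :=
        mul_le_mul_of_nonneg_left hqn (norm_nonneg _)
      nlinarith [Real.exp_pos (-2 * π * y), norm_nonneg (r (n+1))]
    have hsum2 : Summable fun n : ℕ => (‖r (n + 1)‖ * q₁ ^ n) * Real.exp (-2 * π * y) :=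
      hCsum.mul_right _
    calc ‖∑' n : ℕ, r (n + 1) * q ^ (n + 1)‖
        ≤ ∑' n : ℕ, ‖r (n + 1) * q ^ (n + 1)‖ := norm_tsum_le_tsum_norm
            (Summable.of_nonneg_of_le (fun n => norm_nonneg _) hle hsum2)
      _ ≤ ∑' n : ℕ, (‖r (n + 1)‖ * q₁ ^ n) * Real.exp (-2 * π * y) :=
            Summable.tsum_le_tsum hle (Summable.of_nonneg_of_le (fun n => norm_nonneg _) hle hsum2) hsum2
      _ = C * Real.exp (-2 * π * y) := by rw [tsum_mul_right]
  exact hbound.trans_lt hlt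

end Summit.BirchSwinnertonDyer.BirchSwinnertonDyer.Theorems.HeckeTheta

end
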